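import Summits.ValiantsHypothesis.ValiantsHypothesis.Theorems.LacunarySymmetroidMatrixDescartesCensusDoorA34SemidefSheet

/-!
# `MatrixDescartes` census — DOOR A at `(3,4)`: the SCHUR SHEET — on the null-top stratum the `3 × 3` determinant count is a
# TWO-BRANCH crossing count for the `2 × 2` corner of the ADJUGATE of the core (`G₂₂ · det(G + s·diag(α,β,0)) = det(adj₂(corner adj G) + s·G₂₂·diag(α,β))`)

HONEST FRAMING.  Object-search cell `pub-symmetroid`, engine seat `val-sym-eng-2` (g4); helper row beside the registered strata line
`Cruxes/DoorA34/Lines/strata.lean` on stmt-ValiantsHypothesis-19980 (`DoorA34 = PosRootLawAt 3 4 18`: OPEN, typed, never asserted here), stub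
`stub_nullTopCeiling` (`det S₃ = 0 ⇒ ≤ 17`) OPEN on the generic sheet `tr(adj S₃·S₂) ≠ 0`.  A rank-two singular top letter is congruent to
`diag(α, β, 0)` (`αβ > 0`: SEMIDEFINITE cell, `αβ < 0`: INDEFINITE cell), and congruence `S_l ↦ Pᵀ S_l P` rescales the determinant by `det P²`, so on the
null-top sheet one may take `S₃ = diag(α,β,0)` and `F(t) = G(t) + t^N·diag(α,β,0)` with the three-letter CORE `G(t) = S₀ + t^{d₁} S₁ + t^{d₂} S₂`.
This file records the structural identity val-sym-eng-2 g3 asked for (DOOR-A34-ENG2G3-REPORT §4(b): «the null-top count in the semidefinite cell is a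
TWO-BRANCH crossing count … offered as the entry point for a kernel semidefinite-cell bound») in kernel form, for ALL `3 × 3` matrices over a commutative ring:

* **`corner_mul_det_add_smul_diagonal`** — `G₂₂ · det(G + x·diag(α,β,0)) = (adj G₁₁ + x·α·G₂₂)·(adj G₀₀ + x·β·G₂₂) − adj G₀₁ · adj G₁₀`:
  multiplied by the TOP WINDOW `G₂₂` (the `(1,3)` trinomial `kᵀGk` of `Census.det_pencil_nullTop_eq_blocks` in this normal form), the unfolding
  quadratic `s ↦ det(G + s·S₃)` becomes the determinant of a `2 × 2` matrix: the adjugate `adj₂ P = [[P₁₁, −P₀₁],[−P₁₀, P₀₀]]` of the `{0,1}` CORNER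
  `P` of `adj G`, shifted by `x·G₂₂·diag(α,β)` (at `x = 0` this is Jacobi's identity `det P = G₂₂·det G`, `SemidefSheet.jacobi_adjugate_minor`);
* **`corner_mul_det_add_smul_semidef`** — the semidefinite normal form `α = β = 1` for SYMMETRIC `G`: `G₂₂·det(G + x·diag(1,1,0)) = (y + λ₊)·(y + λ₋)` with
  `y = x·G₂₂` and the two REAL BRANCHES `λ± = (adj G₀₀ + adj G₁₁)/2 ± √(((adj G₀₀ − adj G₁₁)/2)² + (adj G₀₁)²)` = the eigenvalues of the symmetric corner `P`
  (`branch_lower_le_upper`; `twoBranch_factor` is the scalar identity behind it);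
* **`det_nullTop_semidef_eq_zero_iff`** — hence for the null-top pencil in the semidefinite normal form and any real `t` off the top window
  (`G(t)₂₂ ≠ 0`): `det F(t) = 0` iff `t^N·G(t)₂₂ = −λ₊(t)` or `t^N·G(t)₂₂ = −λ₋(t)` — every determinant root off the top
  window is a CROSSING of the monomial-times-trinomial probe `y(t) = t^N·G(t)₂₂` with one of the two eigenvalue branches of `−P(t)`, `P(t)` the corner of
  `adj G(t)` (entries = `2 × 2` minors of the core: `6`-nomials on the pair sums `dᵢ + dⱼ`, `i, j < 3`).  This is the `m = 2` reading of the `(3,4)`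
  null-top sheet: a symmetric `2 × 2` six-letter matrix function against a three-letter scalar probe.  In the INDEFINITE cell (`β = −α`) the same
  identity holds but the two branches are real only where `(adj G₀₀ + adj G₁₁)² ≥ 4·(adj G₀₁)²` (`corner_mul_det_add_smul_indef`);
  `corner_mul_det_nullTop_pencil` is the pencil form for general `α, β`.

Nothing here bounds any count: no statement about `ζ_sym(3,4)` beyond the registers (`18 ≤ ζ_sym(3,4) ≤ 19`); `DoorA34` and all three stubs stay OPEN;
nothing on `MatrixDescartes` (stmt-ValiantsHypothesis-18050) or `VP ≠ VNP` — VP≠VNP not moved.  [folklore] Schur complement / Jacobi complementary minor;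
`ring`, `Real.mul_self_sqrt`.
-/

-- `Summit.ValiantsHypothesis.ValiantsHypothesis.…` repeats a component by the D-0017 layout
-- (single-conjunct summit), which the `dupNamespace` linter flags; the name is mandated.
set_option linter.dupNamespace false

namespace Summit.ValiantsHypothesis.ValiantsHypothesis.Theorems.LacunarySymmetroidMatrixDescartes.Census.SchurSheet

open scoped BigOperators Matrix
open Polynomial Finset

/-- **SCHUR SHEET IDENTITY** (any commutative ring, any `3 × 3` matrix): `G₂₂ · det(G + x·diag(α,β,0)) =
(adj G₁₁ + x·α·G₂₂)·(adj G₀₀ + x·β·G₂₂) − adj G₀₁ · adj G₁₀`. [folklore] -/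
theorem corner_mul_det_add_smul_diagonal {R : Type*} [CommRing R] (G : Matrix (Fin 3) (Fin 3) R) (α β x : R) :
    G 2 2 * (G + x • Matrix.diagonal ![α, β, 0]).det =
      (G.adjugate 1 1 + x * α * G 2 2) * (G.adjugate 0 0 + x * β * G 2 2) - G.adjugate 0 1 * G.adjugate 1 0 := by
  simp only [Matrix.det_fin_three, Matrix.adjugate_fin_three, Matrix.add_apply, Matrix.smul_apply, Matrix.diagonal_apply, smul_eq_mul]
  simp
  ring

/-- The scalar identity behind the two branches: `(a + y)(b + y) − m² = (y + (a+b)/2 + √Δ)(y + (a+b)/2 − √Δ)`, `Δ = ((a−b)/2)² + m² ≥ 0`. [folklore] -/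
theorem twoBranch_factor (a b m y : ℝ) :
    (a + y) * (b + y) - m * m =
      (y + ((a + b) / 2 + Real.sqrt (((a - b) / 2) ^ 2 + m ^ 2))) * (y + ((a + b) / 2 - Real.sqrt (((a - b) / 2) ^ 2 + m ^ 2))) := by
  have hΔ : 0 ≤ ((a - b) / 2) ^ 2 + m ^ 2 := by positivity
  have hs := Real.mul_self_sqrt hΔ
  nlinarith [hs]

/-- The lower branch is below the upper branch: `(a+b)/2 − √Δ ≤ (a+b)/2 + √Δ`. [folklore] -/
theorem branch_lower_le_upper (a b m : ℝ) :
    (a + b) / 2 - Real.sqrt (((a - b) / 2) ^ 2 + m ^ 2) ≤ (a + b) / 2 + Real.sqrt (((a - b) / 2) ^ 2 + m ^ 2) := by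
  have h := Real.sqrt_nonneg (((a - b) / 2) ^ 2 + m ^ 2)
  linarith

/-- The two branches sandwich the diagonal: `λ₋ ≤ a ≤ λ₊` (`2 × 2` eigenvalue interlacing, entry `a`). [folklore] -/
theorem branch_lower_le_diag_le_upper (a b m : ℝ) :
    (a + b) / 2 - Real.sqrt (((a - b) / 2) ^ 2 + m ^ 2) ≤ a ∧ a ≤ (a + b) / 2 + Real.sqrt (((a - b) / 2) ^ 2 + m ^ 2) := by
  have h1 : |(a - b) / 2| ≤ Real.sqrt (((a - b) / 2) ^ 2 + m ^ 2) := by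
    rw [← Real.sqrt_sq_eq_abs]
    exact Real.sqrt_le_sqrt (by nlinarith [sq_nonneg m])
  have h2 := abs_le.1 h1
  constructor <;> linarith [h2.1, h2.2]

/-- **SEMIDEFINITE NORMAL FORM, TWO REAL BRANCHES.**  For a real SYMMETRIC `3 × 3` matrix `G` and any `x`:
`G₂₂ · det(G + x·diag(1,1,0)) = (x·G₂₂ + λ₊)·(x·G₂₂ + λ₋)`, `λ± = (adj G₀₀ + adj G₁₁)/2 ± √(((adj G₀₀ − adj G₁₁)/2)² + (adj G₀₁)²)` — the eigenvalues
of the symmetric `{0,1}` corner of `adj G`. [folklore] -/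
theorem corner_mul_det_add_smul_semidef (G : Matrix (Fin 3) (Fin 3) ℝ) (hG : G.IsSymm) (x : ℝ) :
    G 2 2 * (G + x • Matrix.diagonal ![(1 : ℝ), 1, 0]).det =
      (x * G 2 2 + ((G.adjugate 0 0 + G.adjugate 1 1) / 2
          + Real.sqrt (((G.adjugate 0 0 - G.adjugate 1 1) / 2) ^ 2 + (G.adjugate 0 1) ^ 2)))
      * (x * G 2 2 + ((G.adjugate 0 0 + G.adjugate 1 1) / 2
          - Real.sqrt (((G.adjugate 0 0 - G.adjugate 1 1) / 2) ^ 2 + (G.adjugate 0 1) ^ 2))) := by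
  rw [corner_mul_det_add_smul_diagonal, ← SemidefSheet.adjugate_01_eq_10_of_isSymm G hG]
  have h := twoBranch_factor (G.adjugate 0 0) (G.adjugate 1 1) (G.adjugate 0 1) (x * G 2 2)
  rw [← h]
  ring

/-- **INDEFINITE NORMAL FORM.**  For a real symmetric `G`: `G₂₂ · det(G + x·diag(1,−1,0)) = −(x·G₂₂)² + (adj G₀₀ − adj G₁₁)·(x·G₂₂) + (adj G₀₀·adj G₁₁ − (adj G₀₁)²)`
— a quadratic in `y = x·G₂₂` whose discriminant `(adj G₀₀ + adj G₁₁)² − 4(adj G₀₁)²` may be NEGATIVE (no real branch there). [folklore] -/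
theorem corner_mul_det_add_smul_indef (G : Matrix (Fin 3) (Fin 3) ℝ) (hG : G.IsSymm) (x : ℝ) :
    G 2 2 * (G + x • Matrix.diagonal ![(1 : ℝ), -1, 0]).det =
      -(x * G 2 2) ^ 2 + (G.adjugate 0 0 - G.adjugate 1 1) * (x * G 2 2) + (G.adjugate 0 0 * G.adjugate 1 1 - (G.adjugate 0 1) ^ 2) := by
  rw [corner_mul_det_add_smul_diagonal, ← SemidefSheet.adjugate_01_eq_10_of_isSymm G hG]
  ring

/-- The three-letter core of a null-top pencil with symmetric letters is symmetric at every real `t`. [folklore] -/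
theorem isSymm_core (d : Fin 3 → ℕ) (S : Fin 3 → Matrix (Fin 3) (Fin 3) ℝ) (hS : ∀ l, (S l).IsSymm) (t : ℝ) :
    (∑ l, t ^ d l • S l).IsSymm := by
  unfold Matrix.IsSymm
  rw [Matrix.transpose_sum]
  refine Finset.sum_congr rfl fun l _ => ?_
  rw [Matrix.transpose_smul, (hS l)]

/-- **ROOTS OFF THE TOP WINDOW ARE BRANCH CROSSINGS** (semidefinite normal form).  For symmetric letters `S₀, S₁, S₂`, any exponents `d`, top exponent `N`
and real `t` with `c(t) = G(t)₂₂ ≠ 0` (`G(t) = Σ_{l<3} t^{d l} S_l`):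
`det(G(t) + t^N·diag(1,1,0)) = 0` iff `t^N·c(t) = −λ₊(t)` or `t^N·c(t) = −λ₋(t)`, `λ±(t)` the two eigenvalue branches of the corner of `adj G(t)`. [folklore] -/
theorem det_nullTop_semidef_eq_zero_iff (d : Fin 3 → ℕ) (S : Fin 3 → Matrix (Fin 3) (Fin 3) ℝ) (hS : ∀ l, (S l).IsSymm) (N : ℕ) (t : ℝ)
    (hc : (∑ l, t ^ d l • S l) 2 2 ≠ 0) :
    ((∑ l, t ^ d l • S l) + t ^ N • Matrix.diagonal ![(1 : ℝ), 1, 0]).det = 0 ↔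
      t ^ N * (∑ l, t ^ d l • S l) 2 2 =
        -(((∑ l, t ^ d l • S l).adjugate 0 0 + (∑ l, t ^ d l • S l).adjugate 1 1) / 2
          + Real.sqrt ((((∑ l, t ^ d l • S l).adjugate 0 0 - (∑ l, t ^ d l • S l).adjugate 1 1) / 2) ^ 2
              + ((∑ l, t ^ d l • S l).adjugate 0 1) ^ 2)) ∨
      t ^ N * (∑ l, t ^ d l • S l) 2 2 =
        -(((∑ l, t ^ d l • S l).adjugate 0 0 + (∑ l, t ^ d l • S l).adjugate 1 1) / 2
          - Real.sqrt ((((∑ l, t ^ d l • S l).adjugate 0 0 - (∑ l, t ^ d l • S l).adjugate 1 1) / 2) ^ 2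
              + ((∑ l, t ^ d l • S l).adjugate 0 1) ^ 2)) := by
  set G : Matrix (Fin 3) (Fin 3) ℝ := ∑ l, t ^ d l • S l with hGdef
  have hG : G.IsSymm := isSymm_core d S hS t
  have key := corner_mul_det_add_smul_semidef G hG (t ^ N)
  constructor
  · intro h
    rw [h, mul_zero] at key
    rcases mul_eq_zero.1 key.symm with h1 | h1
    · exact Or.inl (by linarith)
    · exact Or.inr (by linarith)
  · intro h
    rcases h with h | h
    · have : G 2 2 * (G + t ^ N • Matrix.diagonal ![(1 : ℝ), 1, 0]).det = 0 := by
        rw [key]; apply mul_eq_zero.2; left; linarith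
      exact (mul_eq_zero.1 this).resolve_left hc
    · have : G 2 2 * (G + t ^ N • Matrix.diagonal ![(1 : ℝ), 1, 0]).det = 0 := by
        rw [key]; apply mul_eq_zero.2; right; linarith
      exact (mul_eq_zero.1 this).resolve_left hc

/-- **Pencil form of the Schur sheet identity** (any letters, any exponents, every real `t`): with `G(t)` the three-letter core,
`G(t)₂₂ · det(G(t) + t^N·diag(α,β,0)) = (adj G(t)₁₁ + t^N·α·G(t)₂₂)·(adj G(t)₀₀ + t^N·β·G(t)₂₂) − adj G(t)₀₁ · adj G(t)₁₀`. [folklore] -/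
theorem corner_mul_det_nullTop_pencil (d : Fin 3 → ℕ) (S : Fin 3 → Matrix (Fin 3) (Fin 3) ℝ) (α β : ℝ) (N : ℕ) (t : ℝ) :
    (∑ l, t ^ d l • S l) 2 2 * ((∑ l, t ^ d l • S l) + t ^ N • Matrix.diagonal ![α, β, 0]).det =
      ((∑ l, t ^ d l • S l).adjugate 1 1 + t ^ N * α * (∑ l, t ^ d l • S l) 2 2)
        * ((∑ l, t ^ d l • S l).adjugate 0 0 + t ^ N * β * (∑ l, t ^ d l • S l) 2 2)
        - (∑ l, t ^ d l • S l).adjugate 0 1 * (∑ l, t ^ d l • S l).adjugate 1 0 :=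
  corner_mul_det_add_smul_diagonal _ α β (t ^ N)

end Summit.ValiantsHypothesis.ValiantsHypothesis.Theorems.LacunarySymmetroidMatrixDescartes.Census.SchurSheet
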